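import Literature.IUT.HodgeTheaters.FrobenioidBridgeModels
import HarnessLib

/-!
# NF-bridges, Θ-bridges and ΘNF-Hodge theaters ([IUTchI] Definition 5.5, Corollary 5.6, Remark 5.6.1) —
# abc-iut cell, layer L5 (slice R4), statements-first

Mochizuki, *Inter-universal Teichmüller theory I*, §5 (kurims May-2020 manuscript), pp. 151–154: the
"Frobenioid-theoretic lifting" of Definition 4.6 — NF-bridges, Θ-bridges, ΘNF-Hodge theaters (Def. 5.5 (i)–(iii))
with their morphisms (data recorded: see the docstrings of `NFBridge.Hom` / `ThetaBridge.Hom` — the reading follows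
abc-iut-L5-d4's kernel analysis endorsed by L5-lead 2026-08-25) and associated base objects (`NFBridge.under`, `ThetaBridge.under`, `ThetaNFHodgeTheater.under`
= the `𝒟`-bridges / `𝒟`-ΘNF-Hodge theaters of `BaseHodgeTheaters.lean`), and Corollary 5.6 (i)–(iii) as named,
MODEL-RELATIVE Prop statements (`Cor56i`, `Cor56ii_NF`, `Cor56ii_Theta`, `Cor56ii_HTR`, `Cor56iii`; the earlier
`Cor56ii_HT` is MIS-STATED — bare product codomain, referee finding ref-g G16-F1 — and superseded by `Cor56ii_HTR`, see
the section at the end of the file) over the stub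
`S5Local` of `FrobenioidBridgeModels.lean` (TODO-merge: L5-t4 Def 5.2 / Cor 5.3, L5-t1 Ex 5.1, L5-t2 Def 3.6).
Remark 5.6.1 ("the functorial dynamics of §4 — Props. 4.8 (i),(ii), 4.9, 4.11 — apply to NF-bridges, Θ-bridges,
ΘNF-Hodge theaters, by Cors. 5.3 (ii),(iii), 5.6 (ii)") is recorded by this sentence. Record-only;
[claim: Mochizuki2012, status: disputed]; nothing here takes a side.
-/

namespace Literature.IUT.HodgeTheaters

open CategoryTheory

universe u

namespace BaseThetaDatum

namespace S5Local

variable {𝔡 : BaseThetaDatum.{u}} {S : S5Local 𝔡}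

/-! ### Definition 5.5: NF-bridges, Θ-bridges, ΘNF-Hodge theaters -/

variable (S)

/-- **Definition 5.5 (i)** ([IUTchI] p. 151–152): an *NF-bridge* `(‡ℱ_J ⟶^{‡ψ^NF_⋆} ‡ℱ^⊚ ⇢ ‡ℱ^⊛)`: (a) a capsule
`‡ℱ_J` of `ℱ`-prime-strips with associated `𝒟`-capsule `‡𝒟_J`; (b) isomorphs `‡ℱ^⊚`, `‡ℱ^⊛` of `†ℱ^⊚`, `†ℱ^⊛`; (c) the
arrow `⇢`; (d) "`‡ψ^NF_⋆` is a poly-morphism that lifts [uniquely! — cf. Corollary 5.3, (ii)] a poly-morphism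
`‡φ^NF_⋆ : ‡𝒟_J → ‡𝒟^⊚` such that `‡φ^NF_⋆` forms a `𝒟`-NF-bridge" (Example 5.4 (v)).
[claim: Mochizuki2012, status: disputed] -/
structure NFBridge where
  /-- the finite index set -/
  J : Type
  /-- (a) the capsule `‡ℱ_J` -/
  capsuleF : S.FCapsule J
  /-- (b) `‡ℱ^⊚` -/
  globF : S.FAmbG
  /-- (b) `‡ℱ^⊛` -/
  globFF : S.FAmbGlob
  /-- (c) `‡ℱ^⊚ ⇢ ‡ℱ^⊛` -/
  dash : S.DashArrow globF globFF
  /-- (d) `‡ψ^NF_⋆ = {‡ψ^NF_j}` -/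
  psiNF : FCapsule.PolyHomNF capsuleF globF
  /-- (d) the poly-morphism `‡φ^NF_⋆ : ‡𝒟_J → ‡𝒟^⊚` under `‡ψ^NF_⋆` forms a `𝒟`-NF-bridge (Def. 4.6 (i)). -/
  under_isModel : ∃ (ι : FlStar 𝔡.l ≃ J) (κ : ∀ j, 𝔡.tautStrip ≅ (capsuleF (ι j)).base)
      (δ : 𝔡.DG ≅ S.baseG globF),
    ∀ j v, (psiNF (ι j)).under v = PolyHomNF.conj 𝔡 (Pi.isoApp (κ j) v) δ (𝔡.phiNFj j v)

variable {S} in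
/-- Def. 5.5 (i): "any NF-bridge as above determines an associated `𝒟`-NF-bridge `(‡φ^NF_⋆ : ‡𝒟_J → ‡𝒟^⊚)`".
[claim: Mochizuki2012, status: disputed] -/
def NFBridge.under (B : NFBridge S) : 𝔡.DNFBridge where
  J := B.J
  capsule := B.capsuleF.base
  glob := S.baseG B.globF
  poly j := (B.psiNF j).under
  isModel := B.under_isModel

/-- **Definition 5.5 (ii)** ([IUTchI] p. 152–153): a *Θ-bridge* `(‡ℱ_J ⟶^{‡ψ^Θ_⋆} ‡ℱ_> ⇢ ‡ℋ𝒯^Θ)`: (a) a capsule `‡ℱ_J`;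
(b) a Θ-Hodge theater `‡ℋ𝒯^Θ`; (c) `‡ℱ_>` "the `ℱ`-prime-strip tautologically associated to `‡ℋ𝒯^Θ`"; (d)
"`‡ψ^Θ_⋆ = {‡ψ^Θ_j}_{j∈J}` the collection of poly-morphisms `‡ψ^Θ_j : ‡ℱ_j → ‡ℱ_>` determined [Remark 5.3.1] by a
`𝒟`-Θ-bridge `‡φ^Θ_⋆ = {‡φ^Θ_j : ‡𝒟_j → ‡𝒟_>}`" (Example 5.4 (ii)) — so the data are the capsule, the Hodge theater and
the `𝒟`-Θ-bridge; `‡ψ^Θ_⋆` is `ThetaBridge.psiTheta`. [claim: Mochizuki2012, status: disputed] -/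
structure ThetaBridge where
  /-- the finite index set -/
  J : Type
  /-- (a) the capsule `‡ℱ_J` -/
  capsuleF : S.FCapsule J
  /-- (b) `‡ℋ𝒯^Θ` -/
  HT : S.ThetaHT
  /-- (d) the `𝒟`-Θ-bridge `‡φ^Θ_⋆ : ‡𝒟_J → ‡𝒟_>` (`‡𝒟_>` = the `𝒟`-prime-strip of `‡ℱ_>`) … -/
  underPoly : DCapsule.PolyHom capsuleF.base (FPrimeStrip.base (S.assocStrip HT))
  /-- … which is a `𝒟`-Θ-bridge (Def. 4.6 (ii)). -/
  under_isModel : ∃ (ι : FlStar 𝔡.l ≃ J) (κ : ∀ j, 𝔡.tautStrip ≅ (capsuleF (ι j)).base)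
      (γ : 𝔡.tautStrip ≅ FPrimeStrip.base (S.assocStrip HT)),
    ∀ j v, underPoly (ι j) v =
      {g | ∃ f ∈ 𝔡.modelThetaBridge j v, g = (Pi.isoApp (κ j) v).inv ≫ f ≫ (Pi.isoApp γ v).hom}

variable {S}

/-- Def. 5.5 (ii): "any Θ-bridge as above determines an associated `𝒟`-Θ-bridge `(‡φ^Θ_⋆ : ‡𝒟_J → ‡𝒟_>)`".
[claim: Mochizuki2012, status: disputed] -/
def ThetaBridge.under (T : ThetaBridge S) : 𝔡.DThetaBridge where
  J := T.J
  capsule := T.capsuleF.base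
  cod := FPrimeStrip.base (S.assocStrip T.HT)
  poly := T.underPoly
  isModel := T.under_isModel

/-- Def. 5.5 (ii)(c): `‡ℱ_>`, the `ℱ`-prime-strip tautologically associated to `‡ℋ𝒯^Θ`. [claim: Mochizuki2012, status: disputed] -/
def ThetaBridge.cod (T : ThetaBridge S) : S.FPrimeStrip := S.assocStrip T.HT

/-- Def. 5.5 (ii)(d): `‡ψ^Θ_j : ‡ℱ_j → ‡ℱ_>`, the lift of `‡φ^Θ_j` (Example 5.4 (ii); Remark 5.3.1).
[claim: Mochizuki2012, status: disputed] -/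
def ThetaBridge.psiTheta (T : ThetaBridge S) (j : T.J) (v : 𝔡.V) : PolyHom (T.capsuleF j v) (T.cod v) :=
  liftPoly _ _ (T.underPoly j v)

variable (S) in
/-- **Definition 5.5 (iii)** ([IUTchI] p. 153): a *ΘNF-Hodge theater*
`‡ℋ𝒯^{ΘNF} = (‡ℱ^⊛ ⇠ ‡ℱ^⊚ ⟵ ‡ℱ_J ⟶ ‡ℱ_> ⇢ ‡ℋ𝒯^Θ)`: an NF-bridge and a Θ-bridge sharing the capsule `‡ℱ_J` "such that
the associated data `{‡φ^NF_⋆, ‡φ^Θ_⋆}` forms a `𝒟`-ΘNF-Hodge theater" (one capsule isomorphism from the model serving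
both, Def. 4.6 (iii)). [claim: Mochizuki2012, status: disputed] -/
structure ThetaNFHodgeTheater where
  /-- the finite index set -/
  J : Type
  /-- the capsule `‡ℱ_J` -/
  capsuleF : S.FCapsule J
  /-- `‡ℱ^⊚` -/
  globF : S.FAmbG
  /-- `‡ℱ^⊛` -/
  globFF : S.FAmbGlob
  /-- `‡ℱ^⊚ ⇢ ‡ℱ^⊛` -/
  dash : S.DashArrow globF globFF
  /-- `‡ψ^NF_⋆` -/
  psiNF : FCapsule.PolyHomNF capsuleF globF
  /-- `‡ℋ𝒯^Θ` -/
  HT : S.ThetaHT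
  /-- `‡φ^Θ_⋆` -/
  underPolyΘ : DCapsule.PolyHom capsuleF.base (FPrimeStrip.base (S.assocStrip HT))
  /-- the associated base data form a `𝒟`-ΘNF-Hodge theater -/
  under_isModel : ∃ (ι : FlStar 𝔡.l ≃ J) (κ : ∀ j, 𝔡.tautStrip ≅ (capsuleF (ι j)).base)
      (δ : 𝔡.DG ≅ S.baseG globF) (γ : 𝔡.tautStrip ≅ FPrimeStrip.base (S.assocStrip HT)),
    (∀ j v, (psiNF (ι j)).under v = PolyHomNF.conj 𝔡 (Pi.isoApp (κ j) v) δ (𝔡.phiNFj j v)) ∧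
    ∀ j v, underPolyΘ (ι j) v =
      {g | ∃ f ∈ 𝔡.modelThetaBridge j v, g = (Pi.isoApp (κ j) v).inv ≫ f ≫ (Pi.isoApp γ v).hom}

/-- The NF-bridge of a ΘNF-Hodge theater. [claim: Mochizuki2012, status: disputed] -/
def ThetaNFHodgeTheater.toNFBridge (H : ThetaNFHodgeTheater S) : NFBridge S where
  J := H.J
  capsuleF := H.capsuleF
  globF := H.globF
  globFF := H.globFF
  dash := H.dash
  psiNF := H.psiNF
  under_isModel := let ⟨ι, κ, δ, _, h, _⟩ := H.under_isModel; ⟨ι, κ, δ, h⟩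

/-- The Θ-bridge of a ΘNF-Hodge theater. [claim: Mochizuki2012, status: disputed] -/
def ThetaNFHodgeTheater.toThetaBridge (H : ThetaNFHodgeTheater S) : ThetaBridge S where
  J := H.J
  capsuleF := H.capsuleF
  HT := H.HT
  underPoly := H.underPolyΘ
  under_isModel := let ⟨ι, κ, _, γ, _, h⟩ := H.under_isModel; ⟨ι, κ, γ, h⟩

/-- Def. 5.5 (iii): the associated `𝒟`-ΘNF-Hodge theater. [claim: Mochizuki2012, status: disputed] -/
def ThetaNFHodgeTheater.under (H : ThetaNFHodgeTheater S) : 𝔡.DThetaNFHodgeTheater where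
  J := H.J
  capsule := H.capsuleF.base
  glob := S.baseG H.globF
  cod := FPrimeStrip.base (S.assocStrip H.HT)
  polyNF j := (H.psiNF j).under
  polyΘ := H.underPolyΘ
  isModel := H.under_isModel

/-! ### Morphisms (Definition 5.5) and Corollary 5.6 as statements -/

/-- **Definition 5.5 (i), morphisms of NF-bridges** ([IUTchI] p. 152): "`¹ℱ_{J₁} ⥲ ²ℱ_{J₂}` [a capsule-full
poly-isomorphism]; `¹ℱ^⊚ ⥲ ²ℱ^⊚` a poly-isomorphism which lifts a poly-isomorphism `¹𝒟^⊚ ⥲ ²𝒟^⊚` such that the pair …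
forms a morphism between the associated `𝒟`-NF-bridges; `¹ℱ^⊛ ⥲ ²ℱ^⊛` an isomorphism — compatible with the `ψ^NF_⋆` …
as well as with the respective `⇢`'s". DATA RECORDED: the underlying morphism of `𝒟`-NF-bridges (which carries the
bijection of index sets, the capsule-full poly-isomorphism being full) and the poly-isomorphism of `ℱ^⊚`'s over its
`Aut_ε`-orbit. NOT recorded as a free datum: the `ℱ^⊛`-isomorphism — by the compatibility with `⇢` and Cor. 5.3 (i)
(`ℱ^⊛` is category-theoretically rigid) it is DETERMINED by the rest (this is the content of Cor. 5.6 (ii)); the stub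
`S5Local` carries no structure on `⇢` through which to state that compatibility, and a free field would distort
`Cor56ii_NF` into "`Isom(¹ℱ^⊛, ²ℱ^⊛)` is a singleton" (analysis of abc-iut-L5-d4, endorsed by L5-lead, 2026-08-25).
TODO-merge:abc-iut-L5-t1 Ex 5.1 (iii) — re-attach it as "the unique compatible isomorphism".
[claim: Mochizuki2012, status: disputed] -/
structure NFBridge.Hom (B B' : NFBridge S) where
  /-- the poly-isomorphism `¹ℱ^⊚ ⥲ ²ℱ^⊚` -/
  globIso : PolyIso B.globF B'.globF
  /-- the induced morphism of underlying `𝒟`-NF-bridges (carrying the bijection of index sets) … -/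
  under : DNFBridge.Hom 𝔡 B.under B'.under
  /-- … whose `Aut_ε`-orbit of base isomorphisms is the image of `globIso` ("lifts"). -/
  under_orbit : under.orbit = {b | ∃ e ∈ globIso, S.baseGIso e = b}

/-- **Definition 5.5 (ii), morphisms of Θ-bridges** ([IUTchI] p. 153): "`¹ℱ_{J₁} ⥲ ²ℱ_{J₂}` a capsule-full
poly-isomorphism; `¹ℱ_> ⥲ ²ℱ_>` the full poly-isomorphism; `¹ℋ𝒯^Θ ⥲ ²ℋ𝒯^Θ` an isomorphism of Θ-Hodge theaters —
compatible with the `ψ^Θ_⋆` … as well as with the respective `⇢`'s [cf. Corollary 5.6, (i)]". DATA RECORDED: the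
underlying morphism of `𝒟`-Θ-bridges (index bijection; the two poly-isomorphisms are full). The `ℋ𝒯^Θ`-component:
by Cor. 5.6 (i) an isomorphism of Θ-Hodge theaters is the same datum as an isomorphism of the associated
`𝒟`-prime-strips, and its compatibility is with the FULL poly-isomorphism `¹ℱ_> ⥲ ²ℱ_>`, which comprises all of them;
so it is recorded as the full poly-isomorphism `Hom.htPolyIso` (reading fixed after abc-iut-L5-d4's kernel analysis,
endorsed by L5-lead, 2026-08-25: a free isomorphism field would distort Cor. 5.6 (ii) into
"`Isom(¹ℋ𝒯^Θ, ²ℋ𝒯^Θ)` is a singleton"). [claim: Mochizuki2012, status: disputed] -/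
structure ThetaBridge.Hom (T T' : ThetaBridge S) where
  /-- the induced morphism of underlying `𝒟`-Θ-bridges (unique by Prop. 4.8 (ii)) -/
  under : DThetaBridge.Hom 𝔡 T.under T'.under

/-- Def. 5.5 (ii): the `ℋ𝒯^Θ`-component of a morphism of Θ-bridges — the full poly-isomorphism of Θ-Hodge theaters
(see `ThetaBridge.Hom`). [claim: Mochizuki2012, status: disputed] -/
def ThetaBridge.Hom.htPolyIso {T T' : ThetaBridge S} (_ : ThetaBridge.Hom T T') : PolyIso T.HT T'.HT :=
  PolyIso.full _ _

/-- Def. 5.5 (ii): the `ℱ_>`-component of a morphism of Θ-bridges is "the full poly-isomorphism".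
[claim: Mochizuki2012, status: disputed] -/
def ThetaBridge.Hom.codPolyIso {T T' : ThetaBridge S} (_ : ThetaBridge.Hom T T') : PolyIso T.cod T'.cod :=
  PolyIso.full _ _

/-- **Definition 5.5 (iii), morphisms of ΘNF-Hodge theaters**: "a pair of morphisms between the respective associated
NF- and Θ-bridges that are compatible with one another in the sense that they induce the same bijection between the
index sets". [claim: Mochizuki2012, status: disputed] -/
structure ThetaNFHodgeTheater.Hom (H H' : ThetaNFHodgeTheater S) where
  /-- the morphism of NF-bridges -/
  nf : NFBridge.Hom H.toNFBridge H'.toNFBridge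
  /-- the morphism of Θ-bridges -/
  theta : ThetaBridge.Hom H.toThetaBridge H'.toThetaBridge
  /-- same bijection of index sets -/
  compat : nf.under.ι = theta.under.ι

variable (S) in
/-- **Corollary 5.6 (i)** ([IUTchI] p. 153): "the natural functorially induced map from the set of isomorphisms
between two Θ-Hodge theaters to the set of isomorphisms between the respective associated `𝒟`-prime-strips is
bijective". [claim: Mochizuki2012, status: disputed] -/
def Cor56i : Prop :=
  ∀ X Y : S.ThetaHT, Function.Bijective fun e : X ≅ Y =>
    (Pi.isoMk fun v => (S.base v).mapIso (S.assocStripIso e v) :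
      FPrimeStrip.base (S.assocStrip X) ≅ FPrimeStrip.base (S.assocStrip Y))

/-- **Corollary 5.6 (ii), NF-bridges**: isomorphisms of NF-bridges ↔ of their `𝒟`-NF-bridges — with the morphisms as
recorded this says: the poly-isomorphism `¹ℱ^⊚ ⥲ ²ℱ^⊚` lifting a given `Aut_ε`-orbit exists and is unique (rigidity of
`ℱ^⊚` over its base, Cor. 5.3 (i)); MODEL-RELATIVE over the stub. [claim: Mochizuki2012, status: disputed] -/
def Cor56ii_NF (B B' : NFBridge S) : Prop :=
  Function.Bijective (fun φ : NFBridge.Hom B B' => φ.under)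

/-- **Corollary 5.6 (ii), Θ-bridges**: isomorphisms of Θ-bridges ↔ of their `𝒟`-Θ-bridges (a one-element set,
Prop. 4.8 (ii)). [claim: Mochizuki2012, status: disputed] -/
def Cor56ii_Theta (T T' : ThetaBridge S) : Prop :=
  Function.Bijective (fun φ : ThetaBridge.Hom T T' => φ.under)

/-- Cor. 5.6 (ii) for Θ-bridges HOLDS with the morphisms as recorded (all components other than the `𝒟`-Θ-bridge
morphism being full poly-isomorphisms). [claim: Mochizuki2012, status: disputed] -/
theorem cor56ii_theta_holds (T T' : ThetaBridge S) : Cor56ii_Theta T T' :=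
  ⟨fun φ ψ h => by cases φ; cases ψ; cases h; rfl, fun u => ⟨⟨u⟩, rfl⟩⟩

/-- **Corollary 5.6 (ii), ΘNF-Hodge theaters**: isomorphisms of ΘNF-Hodge theaters ↔ of their `𝒟`-ΘNF-Hodge
theaters (through the two underlying bridge morphisms). [claim: Mochizuki2012, status: disputed] -/
def Cor56ii_HT (H H' : ThetaNFHodgeTheater S) : Prop :=
  Function.Bijective (fun φ : ThetaNFHodgeTheater.Hom H H' => (φ.nf.under, φ.theta.under))

/-- **Corollary 5.6 (iii)** ([IUTchI] p. 154): "given an NF-bridge and a Θ-bridge, the set of capsule-full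
poly-isomorphisms … which allow one to glue the given NF- and Θ-bridges together to form a ΘNF-Hodge theater forms an
`F_l^⋇`-torsor" — by the printed proof ("[cf. also Proposition 4.8, (iii)]") the gluings are those of the underlying
base-bridges, `l^⋇` in number. [claim: Mochizuki2012, status: disputed] -/
def Cor56iii (B : NFBridge S) (T : ThetaBridge S) : Prop := Prop48iii B.under T.under

/-! ### Corollary 5.6 (ii) for ΘNF-Hodge theaters, repaired codomain (referee finding ref-g G16-F1)

`Cor56ii_HT` above maps an isomorphism of ΘNF-Hodge theaters to the bare PAIR of its underlying `𝒟`-bridge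
isomorphisms. Print (Cor. 5.6 (ii), p. 153–154) says: "the natural functorially induced map from the set of
isomorphisms between two … ΘNF-Hodge theaters to the set of isomorphisms between the respective … associated
`𝒟`-ΘNF-Hodge theaters is bijective" — and an isomorphism of the ASSOCIATED `𝒟`-ΘNF-Hodge theaters (Def. 4.6 (iii))
is a pair of `𝒟`-bridge isomorphisms inducing the SAME bijection of index sets, i.e. a term of the frozen
`DThetaNFHodgeTheater.Hom 𝔡 H.under H'.under` with its `compat` field. The bare product also contains pairs with
unequal index bijections (there are `l^⋇ ≥ 2` isomorphisms of the underlying `𝒟`-NF-bridges, Prop. 4.8 (i), and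
exactly one of the underlying `𝒟`-Θ-bridges, Prop. 4.8 (ii)), none of which is induced, so `Cor56ii_HT` is
MIS-STATED (its surjectivity half fails wherever the types are inhabited). It is kept byte-identical for importers
and SUPERSEDED by `Cor56ii_HTR` below, whose map is "the natural functorially induced map"
`ThetaNFHodgeTheater.Hom.under` INTO `DThetaNFHodgeTheater.Hom`. -/

/-- Def. 5.5 (iii) / Cor. 5.6 (ii) ([IUTchI] p. 153): "the natural functorially induced map" — an isomorphism of
ΘNF-Hodge theaters induces an isomorphism of the associated `𝒟`-ΘNF-Hodge theaters (Def. 4.6 (iii): the pair of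
underlying `𝒟`-NF-bridge / `𝒟`-Θ-bridge isomorphisms, which induce the same bijection of index sets).
[claim: Mochizuki2012, status: disputed] -/
def ThetaNFHodgeTheater.Hom.under {H H' : ThetaNFHodgeTheater S} (φ : ThetaNFHodgeTheater.Hom H H') :
    DThetaNFHodgeTheater.Hom H.under H'.under :=
  ⟨φ.nf.under, φ.theta.under, φ.compat⟩

/-- **Corollary 5.6 (ii), ΘNF-Hodge theaters — REPAIRED** ([IUTchI] p. 153–154): "the natural functorially induced
map from the set of isomorphisms between two … ΘNF-Hodge theaters to the set of isomorphisms between the respective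
… associated `𝒟`-ΘNF-Hodge theaters is bijective" — the codomain is the type of isomorphisms of the ASSOCIATED
`𝒟`-ΘNF-Hodge theaters `DThetaNFHodgeTheater.Hom 𝔡 H.under H'.under` (under-pair + `compat`). [repaired per ref-g
G16-F1; supersedes `Cor56ii_HT` (mis-stated: bare product codomain)] MODEL-RELATIVE over the stub `S5Local`: by
`cor56ii_HTR_of_NF` it reduces to the NF-bridge case `Cor56ii_NF` (rigidity of `ℱ^⊚` over its base, Cor. 5.3 (i)).
[claim: Mochizuki2012, status: disputed] -/
def Cor56ii_HTR (H H' : ThetaNFHodgeTheater S) : Prop :=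
  Function.Bijective (ThetaNFHodgeTheater.Hom.under : ThetaNFHodgeTheater.Hom H H' → _)

/-- Cor. 5.6 (ii): the ΘNF-Hodge-theater case follows from the NF-bridge case — the Θ-bridge component of an
isomorphism is forced (Prop. 4.8 (ii): `DThetaBridge.Hom.subsingleton` / `.nonempty`) and the compatibility of index
bijections is carried by the associated `𝒟`-ΘNF-Hodge-theater isomorphism. [claim: Mochizuki2012, status: disputed] -/
theorem cor56ii_HTR_of_NF (H H' : ThetaNFHodgeTheater S) (h : Cor56ii_NF H.toNFBridge H'.toNFBridge) :
    Cor56ii_HTR H H' := by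
  constructor
  · rintro ⟨n₁, ⟨t₁⟩, c₁⟩ ⟨n₂, ⟨t₂⟩, c₂⟩ hφψ
    have hn : n₁.under = n₂.under := congrArg DThetaNFHodgeTheater.Hom.nf hφψ
    have ht : t₁ = t₂ := congrArg DThetaNFHodgeTheater.Hom.theta hφψ
    obtain rfl : n₁ = n₂ := h.1 hn
    subst ht
    rfl
  · rintro ⟨un, ut, uc⟩
    obtain ⟨n, rfl⟩ := h.2 un
    exact ⟨⟨n, ⟨ut⟩, uc⟩, rfl⟩

/-- Cor. 5.6 (ii), ΘNF-Hodge theaters: injectivity ALWAYS holds for the Θ-component and the index bijections — two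
isomorphisms of ΘNF-Hodge theaters with the same associated `𝒟`-ΘNF-Hodge-theater isomorphism have the same Θ-bridge
component (the after-merge content of `Cor56ii_HTR` is thus confined to the `ℱ^⊚`-component, cf. `Cor56ii_NF`).
[claim: Mochizuki2012, status: disputed] -/
theorem ThetaNFHodgeTheater.Hom.theta_eq_of_under_eq {H H' : ThetaNFHodgeTheater S}
    (φ ψ : ThetaNFHodgeTheater.Hom H H') (h : φ.under = ψ.under) : φ.theta = ψ.theta := by
  rcases φ with ⟨n₁, ⟨t₁⟩, c₁⟩
  rcases ψ with ⟨n₂, ⟨t₂⟩, c₂⟩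
  have ht : t₁ = t₂ := congrArg DThetaNFHodgeTheater.Hom.theta h
  subst ht
  rfl

end S5Local

end BaseThetaDatum

end Literature.IUT.HodgeTheaters
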